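import Mathlib

/-!
# Gain conversion below the Sturm line

Stub `stub_gainConversion` for the crux `HilbertIntegralOverconvergentIsCongruence`
(line Sketch-ideate-r1-k1): the pure real-arithmetic step of the Siegel–Liouville endgame.
A `p`-adic Schwarz lemma bounds a quantity `x ≤ C'` by `C' * ρ ^ (M + 1)` for every natural `M`
whose Sturm-type line `⌊(12 + c₀ D + M t) μ / 12⌋` is at most `n₀` (`0 < ρ < 1`, `μ, t, c₀ ≥ 1`).
We convert this family of bounds into the single bound `x ≤ C' * A ^ D * R⁻¹ ^ n₀` with constants
`A ≥ 1`, `R > 1` depending only on `ρ, μ, t, c₀`; concretely `R = ρ ^ (-(12 / (μ t)))` and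
`A = ρ ^ (-((12 + c₀) μ / (μ t)))`.  Proof: let `N` be the least `M` whose line exceeds `n₀`;
the Schwarz bound at `N - 1` (or the trivial bound if `N = 0`) gives `x ≤ C' * ρ ^ N`, and the
defining inequality `12 n₀ < (12 + c₀ D + N t) μ` of `N` gives `ρ ^ N ≤ A ^ D * R⁻¹ ^ n₀`.
-/

set_option linter.dupNamespace false

noncomputable section

namespace Summit.Langlands.Langlands.Theorems.HilbertIntegralOverconvergentIsCongruence

/-- **Gain conversion.**  For `0 < ρ < 1` and naturals `μ, t, c₀ ≥ 1` there are real constants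
`A ≥ 1` and `R > 1` such that: whenever `x ≤ C'` (`C' ≥ 0`) and `x ≤ C' * ρ ^ (M + 1)` holds for
every `M` with `⌊(12 + c₀ D + M t) μ / 12⌋ ≤ n₀`, then `x ≤ C' * A ^ D * R⁻¹ ^ n₀` (`D ≥ 1`).
One may take `R = ρ ^ (-(12 / (μ t)))` and `A = ρ ^ (-((12 + c₀) μ / (μ t)))`. -/
theorem stub_gainConversion (ρ : ℝ) (hρ0 : 0 < ρ) (hρ1 : ρ < 1) (μ t c₀ : ℕ) (hμ : 1 ≤ μ)
    (ht : 1 ≤ t) (hc₀ : 1 ≤ c₀) :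
    ∃ A R : ℝ, 1 ≤ A ∧ 1 < R ∧
      ∀ (D n₀ : ℕ) (x C' : ℝ), 1 ≤ D → 0 ≤ C' → x ≤ C' →
        (∀ M : ℕ, ((12 + (((c₀ * D : ℕ) : ℤ) + (M : ℤ) * (t : ℤ))) * (μ : ℤ)).toNat / 12 ≤ n₀ →
          x ≤ C' * ρ ^ (M + 1)) →
        x ≤ C' * A ^ D * R⁻¹ ^ n₀ := by
  have hμpos : (0 : ℝ) < μ := Nat.cast_pos.mpr hμ
  have htpos : (0 : ℝ) < t := Nat.cast_pos.mpr ht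
  have hc₀pos : (0 : ℝ) < c₀ := Nat.cast_pos.mpr hc₀
  have hμt : (0 : ℝ) < μ * t := mul_pos hμpos htpos
  -- the two exponents: `R = ρ ^ (-α)`, `A = ρ ^ (-β)`
  obtain ⟨α, hα⟩ : ∃ α : ℝ, α = 12 / ((μ : ℝ) * t) := ⟨_, rfl⟩
  obtain ⟨β, hβ⟩ : ∃ β : ℝ, β = (12 + (c₀ : ℝ)) * μ / ((μ : ℝ) * t) := ⟨_, rfl⟩
  have hαpos : 0 < α := by
    rw [hα]
    exact div_pos (by norm_num) hμt
  have hβpos : 0 < β := by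
    rw [hβ]
    exact div_pos (mul_pos (add_pos (by norm_num) hc₀pos) hμpos) hμt
  refine ⟨ρ ^ (-β), ρ ^ (-α), ?_, ?_, ?_⟩
  · exact Real.one_le_rpow_of_pos_of_le_one_of_nonpos hρ0 hρ1.le (by linarith)
  · exact Real.one_lt_rpow_of_pos_of_lt_one_of_neg hρ0 hρ1 (by linarith)
  intro D n₀ x C' hD hC' hxC' H
  -- `N` : the least `M` whose Sturm-type line exceeds `n₀`
  obtain ⟨N, hNnot, hNmin⟩ : ∃ N : ℕ, ¬ ((12 + (c₀ * D + N * t)) * μ ≤ 12 * n₀) ∧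
      ∀ m < N, (12 + (c₀ * D + m * t)) * μ ≤ 12 * n₀ := by
    classical
    have hex : ∃ M : ℕ, ¬ ((12 + (c₀ * D + M * t)) * μ ≤ 12 * n₀) := by
      refine ⟨12 * n₀, not_le.mpr ?_⟩
      have h1 : 12 * n₀ ≤ 12 * n₀ * t := Nat.le_mul_of_pos_right _ ht
      have h2 : 12 + (c₀ * D + 12 * n₀ * t) ≤ (12 + (c₀ * D + 12 * n₀ * t)) * μ :=
        Nat.le_mul_of_pos_right _ hμ
      omega
    exact ⟨Nat.find hex, Nat.find_spec hex, fun m hm => not_not.mp (Nat.find_min hex hm)⟩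
  -- the Schwarz bound at `N - 1` (the trivial bound if `N = 0`)
  have hxN : x ≤ C' * ρ ^ N := by
    rcases N with _ | M₀
    · simpa using hxC'
    · apply H M₀
      have hPM₀ : (12 + (c₀ * D + M₀ * t)) * μ ≤ 12 * n₀ := hNmin M₀ M₀.lt_succ_self
      apply Nat.div_le_of_le_mul
      rw [Int.toNat_le]
      exact_mod_cast hPM₀
  -- minimality of `N`, in real form
  have hkey : (12 : ℝ) * n₀ ≤ (12 + c₀) * D * μ + N * μ * t := by
    have h1 : (12 : ℝ) * n₀ < (12 + (c₀ * D + N * t)) * μ := by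
      exact_mod_cast not_le.mp hNnot
    have hD' : (1 : ℝ) ≤ D := by exact_mod_cast hD
    nlinarith [mul_le_mul_of_nonneg_right hD' hμpos.le]
  -- comparison of the exponents
  have hexp : α * n₀ - β * D ≤ (N : ℝ) := by
    have e : α * n₀ - β * D = (12 * n₀ - (12 + c₀) * μ * D) / (μ * t) := by
      rw [hα, hβ]
      ring
    rw [e, div_le_iff₀ hμt]
    nlinarith [hkey]
  -- `A ^ D * R⁻¹ ^ n₀ = ρ ^ (α n₀ - β D)`
  have hA : (ρ ^ (-β)) ^ D = ρ ^ (-β * D) := by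
    rw [← Real.rpow_natCast, ← Real.rpow_mul hρ0.le]
  have hR : (ρ ^ (-α))⁻¹ ^ n₀ = ρ ^ (α * n₀) := by
    rw [Real.rpow_neg hρ0.le, inv_inv, ← Real.rpow_natCast, ← Real.rpow_mul hρ0.le]
  have hprod : (ρ ^ (-β)) ^ D * (ρ ^ (-α))⁻¹ ^ n₀ = ρ ^ (α * n₀ - β * D) := by
    rw [hA, hR, ← Real.rpow_add hρ0]
    congr 1
    ring
  calc x ≤ C' * ρ ^ N := hxN
    _ = C' * ρ ^ (N : ℝ) := by rw [Real.rpow_natCast]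
    _ ≤ C' * ρ ^ (α * n₀ - β * D) :=
        mul_le_mul_of_nonneg_left (Real.rpow_le_rpow_of_exponent_ge hρ0 hρ1.le hexp) hC'
    _ = C' * (ρ ^ (-β)) ^ D * (ρ ^ (-α))⁻¹ ^ n₀ := by rw [mul_assoc, hprod]

end Summit.Langlands.Langlands.Theorems.HilbertIntegralOverconvergentIsCongruence

end
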